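import Summits.QuantumFields.YangMills.Theorems.BalabanUVNodesN21LocalAveragedRegularity
import HarnessLib

/-!
# `UnitScaleGibbsBlockPlaquetteSmallFieldCone` — SMALL FIELDS PROPAGATE UP A CONE OF WALK HULLS: level-`i` plaquette, BOND and transporter
# smallness of the (0.4)+`exp[mean log]` tower from level-0 plaquette and bond smallness on the base hull (the FEEDS of the local `j`-fold
# linearisation; S_lin ∕ `stub_linTest` of LINE 28 «gross-sd-transfer»; crux `UnitScaleTilt.HistoryTailL`, stmt-QuantumFields-19936)

Cell `ym3-torus` (YM ladder rung R3 = continuum SU(2) Yang–Mills on T³ — a RUNG, NOT the Clay problem: not d = 4, not infinite volume, not a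
mass gap), width seat `ym-ust-19936-w2` (gen 14).  Construction C3 (`GrossTransferAnnex4.md` §0): on the level-0 small-field event of a
non-wrapping box, the AXIAL-GAUGE REPRESENTATIVE `V` has every box BOND within `η₀ = 2nθ` of `1` (✓`T4AxialGaugeSmallField.dist1_gaugeAct_axialGauge_le_uniform`)
and every box plaquette within `a₀ = θ` of `1`.  The local `j`-fold linearisation (companion `UnitScaleGibbsBlockPlaquetteTransportFreeLinearisationLocal`,
hypotheses (a) «plaquettes of `V̄^{i}` small on the hull `walkEnd (c i) v`, `|v| ≤ R i`» and (b) «one-step transporters of `V̄^{i}` at the coarse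
sites of the hull of `c (i+1)` within `τ i` of `1`») needs these sizes AT EVERY LEVEL `i < j` of the cone `c i = emb (c (i+1))`,
`L·R(i+1) + (d+4)L + 2 ≤ R i`.  THIS FILE derives them from the level-0 data by the elementary recursions
  `a(i+1) ≥ L²·a i + 143·((((d+4)L)²/4)·a i)²`  (Prop. 1 (51) sharp and local: ✓`N21LocalAveragedRegularity.dist1_plaqHol_avgFun_le_sharp_loc`),
  `η(i+1) ≥ 6·(((d+2)L)²/4)·a i + L·η i`        (`V̄(b′) = corr · axial`: the correction factor from the loop variables, ✓`dist1_expMeanLogSU_avg_le`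
                                                  with ✓`N21…dist1_loopHol_le_loc_src`; the straight transporter = `L` bonds),
  `τ i = (d+4)L·η i`                              (a transporter `T_J·T^J_{s,t}` traverses `≤ d(L−1)/2 + 2(L−1)` bonds; `dist₁` is subadditive).

WHAT THIS FILE PROVES (kernel; 0 `def`, 0 `sorry`):
* §1 walk letters: `walkEnd_emb_walkEnd_eq` (CROSSING ONE LEVEL IN THE CONE: `walkEnd (emb (walkEnd c′ v)) v″ = walkEnd c u`, `|u| ≤ L|v| + |v″|`);
* §2 ★ `dist1_holAt_walk_le_of_bondSmall` (`dist₁(U(walk)) ≤ |w|·η` from walk-local BOND smallness), `dist1_rowProd_le_of_bondSmall`,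
  ★ `dist1_transporter_le_of_bondSmall` (`dist₁(T_J·T^J_{s,t}) ≤ (d+4)L·η`);
* §3 ★★ `dist1_avgFun_le_loc` — ONE STEP FOR BONDS: `dist₁(V̄(⟨y, κ⟩)) ≤ 6·(((d+2)L)²/4)·a + L·η` from walk-local plaquette (`(d+2)L + 2`) and bond
  (`L`) smallness at `emb y`;
* §4 ★★★ `smallFieldCone` — the induction: level-`j` plaquette AND bond smallness on the hull `(c j, R j)` from level-0 data on `(c 0, R 0)`;
  ★★ `smallFieldCone_transporter` — hypothesis (b) of the local `j`-fold linearisation, fed: `τ i = (d+4)L·η i`.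

HONEST FRAMING.  Deterministic lattice bookkeeping on the tree's own objects (`--supports stmt-QuantumFields-19936`); crude constants and hull radii;
proves no stub, crux, rung or summit statement; `stub_linTest`, «ShallowFluxSecondMomentL», (Q), K1, `MeanDeviationL`, `HistoryTailL` are NOT
proved; the Yang–Mills mass gap is NOT proved.

References: [Balaban1985Averaging] T. Bałaban, CMP 98 (1985) 17–51, (9) p. 19, (19)–(20) p. 21, Prop. 1 (51) pp. 25–26; [Balaban1987RG1]
T. Bałaban, CMP 109 (1987) 249–301, (0.1)–(0.4), (0.11) pp. 251–253; [Balaban1985UV3] T. Bałaban, CMP 102 (1985) 255–275, (38)–(40) p. 266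
(small-field regions shrink level by level).
-/

noncomputable section

set_option autoImplicit false

open scoped BigOperators

namespace Summit.QuantumFields.YangMills.Theorems.UnitScaleGibbsBlockPlaquetteSmallFieldCone

open Literature.MathematicalPhysics.QuantumFieldTheory.Balaban1983to89
open T4Continuum T4ReflectionCone BlockAveraging AveragingRT B10Eq47AxialChi ExpMeanLog LatticeWordStokes BlockAveragingEMLProp2
  BlockAveragingPlaquetteBound
open Summit.QuantumFields.YangMills.Theorems.N21LocalAveragedRegularity (dist1_loopHol_le_loc_src dist1_plaqHol_avgFun_le_sharp_loc)
open Summit.QuantumFields.YangMills.BalabanUVNodes.N20LCSAvgDomination (shiftN_eq_walkEnd_replicate)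

variable {P : Params}

/-! ## §1 Walk letters: refined walks from block centres, crossing one level -/

section Walks

variable {j : ℕ}

/-- The straight walk of `L` steps `−e_μ` from the centre of `B(y)` ends at the centre of `B(y − e_μ)` (= ✓`Prop8IterTransport.walkEnd_replicate_L_false`,
re-derived to keep the import closure small). [folklore] -/
private theorem walkEnd_replicate_L_false (y : Site P (j + 1)) (μ : Fin P.d) :
    walkEnd (emb y) (List.replicate P.L (μ, false)) = emb (y.unshift μ) := by
  have h := walkEnd_walkEnd_wordRev (emb (y.unshift μ)) (List.replicate P.L (μ, true))
  rw [walkEnd_replicate_L, Site.shift_unshift, wordRev_replicate] at h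
  exact h

/-- The end of the `L`-dilated walk from a block centre is the block centre of the end of the coarse walk (= ✓`Prop7FlatHolonomy.walkEnd_emb_flatMap`,
re-derived). [cite: Balaban1987RG1, (0.1) p.252] -/
private theorem walkEnd_emb_flatMap : ∀ (y : Site P (j + 1)) (w : List (Letter P.d)),
    walkEnd (emb y) (w.flatMap fun l => List.replicate P.L l) = emb (walkEnd y w)
  | y, [] => by simp [walkEnd]
  | y, (μ, true) :: w => by
    rw [List.flatMap_cons, walkEnd_append, walkEnd_replicate_L, walkEnd_emb_flatMap (y.shift μ) w]
    rfl
  | y, (μ, false) :: w => by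
    rw [List.flatMap_cons, walkEnd_append, walkEnd_replicate_L_false, walkEnd_emb_flatMap (y.unshift μ) w]
    rfl

/-- The dilated walk has length `L·|w|`. [folklore] -/
private theorem length_flatMap_replicate : ∀ w : List (Letter P.d), (w.flatMap fun l => List.replicate P.L l).length = P.L * w.length
  | [] => by simp
  | l :: w => by
    rw [List.flatMap_cons, List.length_append, List.length_replicate, length_flatMap_replicate w, List.length_cons]
    ring

/-- **CROSSING ONE LEVEL IN THE CONE**: if `c = emb c′` and `L·R′ + R₀ ≤ R`, then for every coarse walk `v` from `c′` of length `≤ R′` and every fine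
walk `v″` of length `≤ R₀`, the site `walkEnd (emb (walkEnd c′ v)) v″` is `walkEnd c u` for a fine walk `u` of length `≤ R` (namely
`u = v.flatMap (replicate L) ++ v″`). [cite: Balaban1987RG1, (0.1)-(0.3) pp.251-252] -/
theorem walkEnd_emb_walkEnd_eq {c : Site P j} {c' : Site P (j + 1)} (hc : c = emb c') {R R' R₀ : ℕ} (hR : P.L * R' + R₀ ≤ R)
    (v : List (Letter P.d)) (hv : v.length ≤ R') (v'' : List (Letter P.d)) (hv'' : v''.length ≤ R₀) :
    ∃ u : List (Letter P.d), u.length ≤ R ∧ walkEnd (emb (walkEnd c' v)) v'' = walkEnd c u := by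
  subst hc
  refine ⟨(v.flatMap fun l => List.replicate P.L l) ++ v'', ?_, ?_⟩
  · rw [List.length_append, length_flatMap_replicate]
    have h := Nat.mul_le_mul_left P.L hv
    omega
  · rw [walkEnd_append, walkEnd_emb_flatMap]

end Walks

/-! ## §2 Holonomies, straight products and transporters from walk-local BOND smallness -/

section Bonds

variable {j : ℕ} {G : Type*} [GaugeGroup G]

/-- ★ **HOLONOMY ALONG A WALK FROM WALK-LOCAL BOND SMALLNESS**: if every bond `⟨walkEnd c v, κ⟩`, `|v| ≤ R`, of `U` is within `η` of `1` in `dist₁`,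
then for every walk `w` from `walkEnd c u` with `|u| + |w| ≤ R`, `dist₁(U(walk)) ≤ |w|·η` (`dist₁` is subadditive and inversion invariant; a backward
letter at `x` traverses the bond issuing from `x − e_μ = walkEnd c (u ++ [−e_μ])`). [cite: Balaban1985Averaging, (9) p.19 and (19)-(20) p.21] -/
theorem dist1_holAt_walk_le_of_bondSmall (U : GaugeField P j G) (c : Site P j) {R : ℕ} {η : ℝ}
    (hB : ∀ v : List (Letter P.d), v.length ≤ R → ∀ κ : Fin P.d, dist1 (U ⟨walkEnd c v, κ⟩) ≤ η) :
    ∀ (w u : List (Letter P.d)), u.length + w.length ≤ R → dist1 (holAt U (walk (walkEnd c u) w)) ≤ w.length * η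
  | [], u, _ => by simp [walk, holAt_nil, GaugeGroup.dist1_one]
  | (μ, true) :: w, u, h => by
    rw [List.length_cons] at h
    have ih := dist1_holAt_walk_le_of_bondSmall U c hB w (u ++ [(μ, true)]) (by rw [List.length_append, List.length_singleton]; omega)
    have e : (walkEnd c u).shift μ = walkEnd c (u ++ [(μ, true)]) := by rw [walkEnd_append]; rfl
    rw [show walk (walkEnd c u) ((μ, true) :: w) = ⟨⟨walkEnd c u, μ⟩, true⟩ :: walk ((walkEnd c u).shift μ) w from rfl, holAt_cons]
    simp only [↓reduceIte, List.length_cons, Nat.cast_succ]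
    calc dist1 (U ⟨walkEnd c u, μ⟩ * holAt U (walk ((walkEnd c u).shift μ) w))
        ≤ dist1 (U ⟨walkEnd c u, μ⟩) + dist1 (holAt U (walk ((walkEnd c u).shift μ) w)) := GaugeGroup.dist1_mul_le _ _
      _ ≤ η + w.length * η := add_le_add (hB u (by omega) μ) (by rw [e]; exact ih)
      _ = (w.length + 1) * η := by ring
  | (μ, false) :: w, u, h => by
    rw [List.length_cons] at h
    have ih := dist1_holAt_walk_le_of_bondSmall U c hB w (u ++ [(μ, false)]) (by rw [List.length_append, List.length_singleton]; omega)
    have e : (walkEnd c u).unshift μ = walkEnd c (u ++ [(μ, false)]) := by rw [walkEnd_append]; rfl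
    rw [show walk (walkEnd c u) ((μ, false) :: w) = ⟨⟨(walkEnd c u).unshift μ, μ⟩, false⟩ :: walk ((walkEnd c u).unshift μ) w from rfl,
      holAt_cons]
    simp only [Bool.false_eq_true, ↓reduceIte, List.length_cons, Nat.cast_succ]
    calc dist1 ((U ⟨(walkEnd c u).unshift μ, μ⟩)⁻¹ * holAt U (walk ((walkEnd c u).unshift μ) w))
        ≤ dist1 ((U ⟨(walkEnd c u).unshift μ, μ⟩)⁻¹) + dist1 (holAt U (walk ((walkEnd c u).unshift μ) w)) := GaugeGroup.dist1_mul_le _ _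
      _ ≤ η + w.length * η := by
          refine add_le_add ?_ (by rw [e]; exact ih)
          rw [GaugeGroup.dist1_inv, e]
          exact hB _ (by rw [List.length_append, List.length_singleton]; omega) μ
      _ = (w.length + 1) * η := by ring

/-- The straight product of `t` bonds from `walkEnd c u` in direction `ν` is within `t·η` of `1` when `|u| + t ≤ R`. [cite: Balaban1985Averaging, (9) p.19] -/
theorem dist1_rowProd_le_of_bondSmall (U : GaugeField P j G) (c : Site P j) {R : ℕ} {η : ℝ}
    (hB : ∀ v : List (Letter P.d), v.length ≤ R → ∀ κ : Fin P.d, dist1 (U ⟨walkEnd c v, κ⟩) ≤ η)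
    (u : List (Letter P.d)) (ν : Fin P.d) (t : ℕ) (h : u.length + t ≤ R) :
    dist1 (rowProd U (walkEnd c u) ν t) ≤ t * η := by
  rw [← holAt_walk_replicate_true]
  have h' := dist1_holAt_walk_le_of_bondSmall U c hB (List.replicate t (ν, true)) u (by rw [List.length_replicate]; exact h)
  rw [List.length_replicate] at h'
  exact h'

/-- ★ **THE ONE-STEP TRANSPORTER FROM BOND SMALLNESS**: the transporter `T_J·T^J_{s,t} = U(Γ^σ_{x₀→x_J})·rowProd U x_J ν t·rowProd U (x_J + t e_ν) μ s`
(`x₀ = walkEnd c u`, `x_J = walkEnd x₀ Γ^σ(off r)`, `t, s < L`) traverses at most `d(L−1)/2 + 2(L−1) ≤ (d+4)L` bonds, all issuing from walk sites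
`walkEnd c v`, `|v| ≤ |u| + (d+4)L`; so it is within `(d+4)L·η` of `1` when those bonds are within `η ≥ 0` of `1`.
[cite: Balaban1985Averaging, (9) p.19 and (19)-(20) p.21; Balaban1987RG1, (0.3)-(0.4) pp.252-253] -/
theorem dist1_transporter_le_of_bondSmall (U : GaugeField P j G) (c : Site P j) {R : ℕ} {η : ℝ} (hη : 0 ≤ η)
    (hB : ∀ v : List (Letter P.d), v.length ≤ R → ∀ κ : Fin P.d, dist1 (U ⟨walkEnd c v, κ⟩) ≤ η)
    (u : List (Letter P.d)) (hu : u.length + (P.d + 4) * P.L ≤ R) (μ ν : Fin P.d) (σ : Equiv.Perm (Fin P.d)) (r : Fin P.d → Fin P.L)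
    (t s : ℕ) (ht : t < P.L) (hs : s < P.L) :
    dist1 (holAt U (walk (walkEnd c u) (stairWord σ (off r))) *
        (rowProd U (walkEnd (walkEnd c u) (stairWord σ (off r))) ν t *
          rowProd U (shiftN (walkEnd (walkEnd c u) (stairWord σ (off r))) ν t) μ s)) ≤ (((P.d + 4) * P.L : ℕ) : ℝ) * η := by
  have hn : ∀ κ, (off r κ).natAbs ≤ (P.L - 1) / 2 := fun κ => by
    have h := off_bounds r κ
    omega
  have hlen := length_stairWord_le σ (off r) _ hn
  have hdL : P.d * ((P.L - 1) / 2) ≤ P.d * P.L := Nat.mul_le_mul_left _ (by omega)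
  have e : (P.d + 4) * P.L = P.d * P.L + 4 * P.L := by ring
  -- the three factors
  have h1 : dist1 (holAt U (walk (walkEnd c u) (stairWord σ (off r)))) ≤ (stairWord σ (off r)).length * η :=
    dist1_holAt_walk_le_of_bondSmall U c hB _ u (by omega)
  have e2 : walkEnd (walkEnd c u) (stairWord σ (off r)) = walkEnd c (u ++ stairWord σ (off r)) := by rw [walkEnd_append]
  have h2 : dist1 (rowProd U (walkEnd (walkEnd c u) (stairWord σ (off r))) ν t) ≤ t * η := by
    rw [e2]
    exact dist1_rowProd_le_of_bondSmall U c hB _ ν t (by rw [List.length_append]; omega)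
  have e3 : shiftN (walkEnd (walkEnd c u) (stairWord σ (off r))) ν t = walkEnd c (u ++ stairWord σ (off r) ++ List.replicate t (ν, true)) := by
    rw [shiftN_eq_walkEnd_replicate, e2, ← walkEnd_append]
  have h3 : dist1 (rowProd U (shiftN (walkEnd (walkEnd c u) (stairWord σ (off r))) ν t) μ s) ≤ s * η := by
    rw [e3]
    exact dist1_rowProd_le_of_bondSmall U c hB _ μ s (by rw [List.length_append, List.length_append, List.length_replicate]; omega)
  have hcount : ((stairWord σ (off r)).length : ℝ) + t + s ≤ (((P.d + 4) * P.L : ℕ) : ℝ) := by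
    have : (stairWord σ (off r)).length + t + s ≤ (P.d + 4) * P.L := by omega
    exact_mod_cast this
  calc dist1 (holAt U (walk (walkEnd c u) (stairWord σ (off r))) *
          (rowProd U (walkEnd (walkEnd c u) (stairWord σ (off r))) ν t *
            rowProd U (shiftN (walkEnd (walkEnd c u) (stairWord σ (off r))) ν t) μ s))
      ≤ dist1 (holAt U (walk (walkEnd c u) (stairWord σ (off r)))) +
          (dist1 (rowProd U (walkEnd (walkEnd c u) (stairWord σ (off r))) ν t) +
            dist1 (rowProd U (shiftN (walkEnd (walkEnd c u) (stairWord σ (off r))) ν t) μ s)) :=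
        (GaugeGroup.dist1_mul_le _ _).trans (add_le_add le_rfl (GaugeGroup.dist1_mul_le _ _))
    _ ≤ (stairWord σ (off r)).length * η + (t * η + s * η) := add_le_add h1 (add_le_add h2 h3)
    _ = (((stairWord σ (off r)).length : ℝ) + t + s) * η := by ring
    _ ≤ (((P.d + 4) * P.L : ℕ) : ℝ) * η := mul_le_mul_of_nonneg_right hcount hη

end Bonds

/-! ## §3 One averaging step for BONDS -/

section OneStep

open scoped Matrix.Norms.L2Operator

variable {j : ℕ} {n : Type*} [Fintype n] [DecidableEq n] [Nonempty n]

/-- ★★ **ONE STEP FOR BONDS**: `V̄(⟨y, κ⟩) = corr · axial` for the (0.4)+`exp[mean log]` averaging, so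
`dist₁(V̄(⟨y, κ⟩)) ≤ 6·(((d+2)L)²/4)·a + L·η` as soon as every fine plaquette cornered at `walkEnd (emb y) v`, `|v| ≤ (d+2)L + 2`, is within `a ≥ 0`
of `1` with `(((d+2)L)²/4)·a < δ_N` (the loop variables are then within `t = (((d+2)L)²/4)·a` of `1`, ✓`N21…dist1_loopHol_le_loc_src`, and the
correction factor within `6t`, ✓`dist1_expMeanLogSU_avg_le`; off the guard the correction factor is `1`) and every fine bond `⟨walkEnd (emb y) v, κ′⟩`,
`|v| ≤ L`, is within `η` of `1` (the straight transporter is the product of `L` of them). [cite: Balaban1987RG1, (0.4) p.253; Balaban1985Averaging, (19)-(20) p.21] -/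
theorem dist1_avgFun_le_loc {a η : ℝ} (ha : 0 ≤ a) {U : GaugeField P j (Matrix.specialUnitaryGroup n ℂ)} (y : Site P (j + 1)) (κ : Fin P.d)
    (ht : ((((P.d + 2) * P.L : ℕ) : ℝ) ^ 2 / 4) * a < deltaSU n)
    (hU : ∀ v : List (Letter P.d), v.length ≤ (P.d + 2) * P.L + 2 →
      ∀ (a' b : Fin P.d) (h : a' < b), dist1 (GaugeField.plaqHol U ⟨walkEnd (emb y) v, a', b, h⟩) ≤ a)
    (hB : ∀ v : List (Letter P.d), v.length ≤ P.L → ∀ κ' : Fin P.d, dist1 (U ⟨walkEnd (emb y) v, κ'⟩) ≤ η) :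
    dist1 (avgFun (expMeanLogSU (n := n)) U ⟨y, κ⟩) ≤ 6 * (((((P.d + 2) * P.L : ℕ) : ℝ) ^ 2 / 4) * a) + (P.L : ℝ) * η := by
  have hW : ∀ i : Idx P, dist1 (loopHol U ⟨y, κ⟩ i) ≤ ((((P.d + 2) * P.L : ℕ) : ℝ) ^ 2 / 4) * a :=
    dist1_loopHol_le_loc_src ha U y le_rfl hU κ
  have hcorr : dist1 (corr (expMeanLogSU (n := n)) U ⟨y, κ⟩) ≤ 6 * (((((P.d + 2) * P.L : ℕ) : ℝ) ^ 2 / 4) * a) := by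
    unfold corr
    split_ifs
    · exact dist1_expMeanLogSU_avg_le hW ht
    · rw [GaugeGroup.dist1_one]; positivity
  have hax : dist1 (axialAvg U ⟨y, κ⟩) ≤ (P.L : ℝ) * η := by
    rw [axialAvg_eq_holAt_walk]
    have h := dist1_holAt_walk_le_of_bondSmall U (emb y) hB (List.replicate P.L (κ, true)) [] (by rw [List.length_replicate]; simp)
    rw [List.length_replicate] at h
    exact h
  show dist1 (corr (expMeanLogSU (n := n)) U ⟨y, κ⟩ * axialAvg U ⟨y, κ⟩) ≤ _
  exact (GaugeGroup.dist1_mul_le _ _).trans (add_le_add hcorr hax)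

end OneStep

/-! ## §4 The cone induction -/

section Cone

open scoped Matrix.Norms.L2Operator

variable {n : Type*} [Fintype n] [DecidableEq n] [Nonempty n]

omit [DecidableEq n] in
/-- The (0.4) smallness `((d+4)L)²a∕4 ≤ δ_N∕2` implies the loop smallness `((d+2)L)²a∕4 < δ_N` used by the correction factor. [folklore] -/
theorem loopSmall_of_smallness {a : ℝ} (ha : 0 ≤ a) (hs : ((((P.d + 4) * P.L : ℕ) : ℝ) ^ 2 / 4) * a ≤ deltaSU n / 2) :
    ((((P.d + 2) * P.L : ℕ) : ℝ) ^ 2 / 4) * a < deltaSU n := by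
  have hδ : 0 < deltaSU n := deltaSU_pos
  have hmono : ((((P.d + 2) * P.L : ℕ) : ℝ) ^ 2 / 4) * a ≤ ((((P.d + 4) * P.L : ℕ) : ℝ) ^ 2 / 4) * a := by
    have h : (((P.d + 2) * P.L : ℕ) : ℝ) ≤ (((P.d + 4) * P.L : ℕ) : ℝ) := by
      exact_mod_cast Nat.mul_le_mul_right _ (by omega)
    have h0 : (0 : ℝ) ≤ (((P.d + 2) * P.L : ℕ) : ℝ) := Nat.cast_nonneg _
    gcongr
  linarith

/-- ★★★ **SMALL FIELDS PROPAGATE UP THE CONE.**  Let `V : GaugeField P 0 SU(N)`, `V̄^{i} := Averaging.iter (blockAvg expMeanLogSU) i V`, and let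
`c i : Site P i`, `R i : ℕ` be a cone (`c i = emb (c (i+1))`, `L·R(i+1) + (d+4)L + 2 ≤ R i` for `i < j`).  If on the base hull every plaquette
`⟨walkEnd (c 0) v; a < b⟩`, `|v| ≤ R 0`, of `V` is within `a 0 ≥ 0` of `1` and every bond `⟨walkEnd (c 0) v, κ⟩` within `η 0 ≥ 0`, and the sizes obey
`(((d+4)L)²/4)·a i ≤ δ_N/2`, `L²·a i + 143·((((d+4)L)²/4)·a i)² ≤ a (i+1)` and `6·(((d+2)L)²/4)·a i + L·η i ≤ η (i+1)` for `i < j`, then at level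
`j`: `0 ≤ a j`, `0 ≤ η j`, every plaquette of `V̄^{j}` cornered at `walkEnd (c j) v`, `|v| ≤ R j`, is within `a j` of `1`, and every bond of `V̄^{j}`
issuing from such a site is within `η j` of `1`. [cite: Balaban1985Averaging, Prop. 1 (51) pp.25-26; Balaban1987RG1, (0.4) and (0.11) p.253; Balaban1985UV3, (38)-(40) p.266] -/
theorem smallFieldCone (V : GaugeField P 0 (Matrix.specialUnitaryGroup n ℂ)) (a η : ℕ → ℝ) (c : (i : ℕ) → Site P i) (R : ℕ → ℕ) :
    ∀ j : ℕ,
      (∀ i, i < j → c i = emb (c (i + 1))) →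
      (∀ i, i < j → P.L * R (i + 1) + ((P.d + 4) * P.L + 2) ≤ R i) →
      0 ≤ a 0 → 0 ≤ η 0 →
      (∀ v : List (Letter P.d), v.length ≤ R 0 → ∀ (a' b : Fin P.d) (h : a' < b),
        dist1 (GaugeField.plaqHol V ⟨walkEnd (c 0) v, a', b, h⟩) ≤ a 0) →
      (∀ v : List (Letter P.d), v.length ≤ R 0 → ∀ κ : Fin P.d, dist1 (V ⟨walkEnd (c 0) v, κ⟩) ≤ η 0) →
      (∀ i, i < j → ((((P.d + 4) * P.L : ℕ) : ℝ) ^ 2 / 4) * a i ≤ deltaSU n / 2) →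
      (∀ i, i < j → (P.L : ℝ) ^ 2 * a i + 143 * (((((P.d + 4) * P.L : ℕ) : ℝ) ^ 2 / 4) * a i) ^ 2 ≤ a (i + 1)) →
      (∀ i, i < j → 6 * (((((P.d + 2) * P.L : ℕ) : ℝ) ^ 2 / 4) * a i) + (P.L : ℝ) * η i ≤ η (i + 1)) →
      0 ≤ a j ∧ 0 ≤ η j ∧
        (∀ v : List (Letter P.d), v.length ≤ R j → ∀ (a' b : Fin P.d) (h : a' < b),
          dist1 (GaugeField.plaqHol (Averaging.iter (fun i' => blockAvg (P := P) (j := i') (expMeanLogSU (n := n))) j V)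
            ⟨walkEnd (c j) v, a', b, h⟩) ≤ a j) ∧
        (∀ v : List (Letter P.d), v.length ≤ R j → ∀ κ : Fin P.d,
          dist1 (Averaging.iter (fun i' => blockAvg (P := P) (j := i') (expMeanLogSU (n := n))) j V ⟨walkEnd (c j) v, κ⟩) ≤ η j)
  | 0, _, _, ha0, hη0, hplaq0, hbond0, _, _, _ => ⟨ha0, hη0, hplaq0, hbond0⟩
  | j + 1, hc, hR, ha0, hη0, hplaq0, hbond0, hs, hstepa, hstepη => by
    obtain ⟨haj, hηj, hplaq, hbond⟩ := smallFieldCone V a η c R j (fun i hi => hc i (Nat.lt_succ_of_lt hi))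
      (fun i hi => hR i (Nat.lt_succ_of_lt hi)) ha0 hη0 hplaq0 hbond0 (fun i hi => hs i (Nat.lt_succ_of_lt hi))
      (fun i hi => hstepa i (Nat.lt_succ_of_lt hi)) (fun i hi => hstepη i (Nat.lt_succ_of_lt hi))
    have hj := Nat.lt_succ_self j
    have e : Averaging.iter (fun i' => blockAvg (P := P) (j := i') (expMeanLogSU (n := n))) (j + 1) V =
        avgFun (expMeanLogSU (n := n)) (Averaging.iter (fun i' => blockAvg (P := P) (j := i') (expMeanLogSU (n := n))) j V) := rfl
    -- crossing one level: the one-step hulls around `emb (walkEnd (c (j+1)) v)` lie in the level-`j` hull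
    have hcross : ∀ (v : List (Letter P.d)), v.length ≤ R (j + 1) → ∀ v'' : List (Letter P.d), v''.length ≤ (P.d + 4) * P.L + 2 →
        ∃ u : List (Letter P.d), u.length ≤ R j ∧ walkEnd (emb (walkEnd (c (j + 1)) v)) v'' = walkEnd (c j) u :=
      fun v hv v'' hv'' => walkEnd_emb_walkEnd_eq (hc j hj) (hR j hj) v hv v'' hv''
    have hU' : ∀ (v : List (Letter P.d)), v.length ≤ R (j + 1) → ∀ v'' : List (Letter P.d), v''.length ≤ (P.d + 4) * P.L + 2 →
        ∀ (a' b : Fin P.d) (h : a' < b),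
        dist1 (GaugeField.plaqHol (Averaging.iter (fun i' => blockAvg (P := P) (j := i') (expMeanLogSU (n := n))) j V)
          ⟨walkEnd (emb (walkEnd (c (j + 1)) v)) v'', a', b, h⟩) ≤ a j := fun v hv v'' hv'' a' b h => by
      obtain ⟨u, hu, e'⟩ := hcross v hv v'' hv''
      rw [e']
      exact hplaq u hu a' b h
    have hB' : ∀ (v : List (Letter P.d)), v.length ≤ R (j + 1) → ∀ v'' : List (Letter P.d), v''.length ≤ (P.d + 4) * P.L + 2 →
        ∀ κ : Fin P.d, dist1 (Averaging.iter (fun i' => blockAvg (P := P) (j := i') (expMeanLogSU (n := n))) j V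
          ⟨walkEnd (emb (walkEnd (c (j + 1)) v)) v'', κ⟩) ≤ η j := fun v hv v'' hv'' κ => by
      obtain ⟨u, hu, e'⟩ := hcross v hv v'' hv''
      rw [e']
      exact hbond u hu κ
    have h24 : (P.d + 2) * P.L + 2 ≤ (P.d + 4) * P.L + 2 := by nlinarith
    have hL4 : P.L ≤ (P.d + 4) * P.L + 2 := by nlinarith
    refine ⟨?_, ?_, fun v hv a' b h => ?_, fun v hv κ => ?_⟩
    · have h1 := hstepa j hj
      nlinarith [sq_nonneg (((((P.d + 4) * P.L : ℕ) : ℝ) ^ 2 / 4) * a j), sq_nonneg (P.L : ℝ)]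
    · have h1 := hstepη j hj
      have h2 : (0 : ℝ) ≤ 6 * (((((P.d + 2) * P.L : ℕ) : ℝ) ^ 2 / 4) * a j) := by positivity
      have h3 : (0 : ℝ) ≤ (P.L : ℝ) * η j := by positivity
      linarith
    · rw [e]
      exact (dist1_plaqHol_avgFun_le_sharp_loc haj (hs j hj) ⟨walkEnd (c (j + 1)) v, a', b, h⟩ (hU' v hv)).trans (hstepa j hj)
    · rw [e]
      exact (dist1_avgFun_le_loc haj (walkEnd (c (j + 1)) v) κ (loopSmall_of_smallness haj (hs j hj))
        (fun v'' hv'' a' b h => hU' v hv v'' (hv''.trans h24) a' b h) (fun v'' hv'' κ' => hB' v hv v'' (hv''.trans hL4) κ')).trans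
        (hstepη j hj)

/-- ★★ **THE TRANSPORTER FEED OF THE LOCAL `j`-FOLD LINEARISATION**: under the hypotheses of `smallFieldCone` at height `j`, for every `i < j`,
every coarse site `y = walkEnd (c (i+1)) v`, `|v| ≤ R(i+1)`, all directions and all `J = (r, σ, …)`, `t, s < L`, the one-step transporter
`holAt V̄^{i} (walk (emb y) Γ^σ(off r)) · rowProd V̄^{i} x_J ν t · rowProd V̄^{i} (x_J + t e_ν) μ s` is within `(d+4)L·η i` of `1` in `dist₁`
(hypothesis (b) of ✓`UnitScaleGibbsBlockPlaquetteTransportFreeLinearisationLocal.norm_iter_plaqHol_sub_one_sub_linProxy_le_loc` with `τ i = (d+4)L·η i`).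
[cite: Balaban1985Averaging, (9) p.19 and (19)-(20) p.21; Balaban1987RG1, (0.3)-(0.4) pp.252-253] -/
theorem smallFieldCone_transporter (V : GaugeField P 0 (Matrix.specialUnitaryGroup n ℂ)) (a η : ℕ → ℝ) (c : (i : ℕ) → Site P i)
    (R : ℕ → ℕ) (j : ℕ)
    (hc : ∀ i, i < j → c i = emb (c (i + 1)))
    (hR : ∀ i, i < j → P.L * R (i + 1) + ((P.d + 4) * P.L + 2) ≤ R i)
    (ha0 : 0 ≤ a 0) (hη0 : 0 ≤ η 0)
    (hplaq0 : ∀ v : List (Letter P.d), v.length ≤ R 0 → ∀ (a' b : Fin P.d) (h : a' < b),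
      dist1 (GaugeField.plaqHol V ⟨walkEnd (c 0) v, a', b, h⟩) ≤ a 0)
    (hbond0 : ∀ v : List (Letter P.d), v.length ≤ R 0 → ∀ κ : Fin P.d, dist1 (V ⟨walkEnd (c 0) v, κ⟩) ≤ η 0)
    (hs : ∀ i, i < j → ((((P.d + 4) * P.L : ℕ) : ℝ) ^ 2 / 4) * a i ≤ deltaSU n / 2)
    (hstepa : ∀ i, i < j → (P.L : ℝ) ^ 2 * a i + 143 * (((((P.d + 4) * P.L : ℕ) : ℝ) ^ 2 / 4) * a i) ^ 2 ≤ a (i + 1))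
    (hstepη : ∀ i, i < j → 6 * (((((P.d + 2) * P.L : ℕ) : ℝ) ^ 2 / 4) * a i) + (P.L : ℝ) * η i ≤ η (i + 1)) :
    ∀ i, i < j → ∀ v : List (Letter P.d), v.length ≤ R (i + 1) → ∀ (μ ν : Fin P.d)
      (J : (Fin P.d → Fin P.L) × Equiv.Perm (Fin P.d) × Equiv.Perm (Fin P.d) × Equiv.Perm (Fin P.d) × Equiv.Perm (Fin P.d)) (t s : ℕ),
      t < P.L → s < P.L →
      dist1 (holAt (Averaging.iter (fun i' => blockAvg (P := P) (j := i') (expMeanLogSU (n := n))) i V)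
          (walk (emb (walkEnd (c (i + 1)) v)) (stairWord J.2.1 (off J.1))) *
        (rowProd (Averaging.iter (fun i' => blockAvg (P := P) (j := i') (expMeanLogSU (n := n))) i V)
            (walkEnd (emb (walkEnd (c (i + 1)) v)) (stairWord J.2.1 (off J.1))) ν t *
          rowProd (Averaging.iter (fun i' => blockAvg (P := P) (j := i') (expMeanLogSU (n := n))) i V)
            (shiftN (walkEnd (emb (walkEnd (c (i + 1)) v)) (stairWord J.2.1 (off J.1))) ν t) μ s)) ≤
        (((P.d + 4) * P.L : ℕ) : ℝ) * η i := by
  intro i hi v hv μ ν J t s ht hs'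
  -- level-`i` bond smallness on the hull `(c i, R i)` (the cone induction at height `i`)
  obtain ⟨_, hηi, _, hbond⟩ := smallFieldCone V a η c R i (fun i' hi' => hc i' (hi'.trans hi)) (fun i' hi' => hR i' (hi'.trans hi))
    ha0 hη0 hplaq0 hbond0 (fun i' hi' => hs i' (hi'.trans hi)) (fun i' hi' => hstepa i' (hi'.trans hi)) (fun i' hi' => hstepη i' (hi'.trans hi))
  -- the coarse site's block centre is a walk site of the level-`i` hull, with room `(d+4)L` to spare
  obtain ⟨u, hu, e⟩ := walkEnd_emb_walkEnd_eq (hc i hi) (R := P.L * R (i + 1)) (R₀ := 0) (by omega) v hv [] (by simp)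
  have e' : emb (walkEnd (c (i + 1)) v) = walkEnd (c i) u := e
  have hu' : u.length + (P.d + 4) * P.L ≤ R i := by have := hR i hi; omega
  rw [e']
  exact dist1_transporter_le_of_bondSmall _ (c i) hηi hbond u hu' μ ν J.2.1 J.1 t s ht hs'

end Cone

end Summit.QuantumFields.YangMills.Theorems.UnitScaleGibbsBlockPlaquetteSmallFieldCone

end
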